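import Mathlib
import HarnessLib

/-!
# Route «KPlusLogSqLaw», `WeakLifting` (stmt-ValiantsHypothesis-19561) — the MIXED-SIGN vertex gauge with ONE fast
# negative mode: at most `n + 2` distinct positive determinant zeros (exponent ratio 3), below Descartes' `n + 3`

HONEST FRAMING.  Helper file (seat val-sym-lift-p4 g26, cell `pub-symmetroid`, 2026-08-29; `--supports 19561 --as helper`,
zero crux credit).  By g25's normal form `RealStatic.kPlusLogSqLaw_iff_signedVertexGauge` (✓ p728102) Conjecture B is the
SIGNED vertex-gauge law `det (C' + diagonal (aᵢ X^{eᵢ}))`; its one-signed sector is the inertia law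
`MonotoneInertia.card_posRoots_vertexGauge_le` (✓, lift-p2 g10), and the whole open content is the MIXED-SIGN sector
(g25 memo REAL-NORMAL-FORMS §5).  This file proves the first bound BELOW DESCARTES in the mixed-sign sector, for the
smallest mixed shape with many slow modes: the bordered pencil
`M(x) = [[A + x^a·1, v], [vᵀ, c − x^{3a}]]` (`A` real symmetric `n × n`, ONE fast negative diagonal mode of exponent `3a`
against `n` slow positive diagonal modes of exponent `a`).  THEOREM (`card_posZeros_le`): `det M(x)` vanishes at no more than
`n + 2` distinct positive `x` — Descartes' rule on the `n + 4` monomials `x^{0..n} ∪ x^{3a..}` (in `x^a`) allows `n + 3`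
(`n ≥ 2`); located numerics (seat memo MIXED-GAUGE-LAW.md) find `n + 2` attained for every `n ≤ 5` and every exponent
ratio tried, and never `n + 3`.
MECHANISM (two lemmas, elementary linear algebra, no eigenvalues): (1) TWO-POINT IDENTITY (`two_point`, any exponents): if
`(w, q)` is a kernel vector at `(s, t) = (x^a, x^b)` and `(w', q')` one at `(s', t')`, then `(s' − s)·⟪w, w'⟫ = (t' − t)·q q'`
(symmetry of `A`); (2) hence, with `t = s³`: two distinct zeros cannot BOTH be «downward» (`‖w‖² ≤ 3 s² q²`, the kernel
direction loses to the fast mode) — Cauchy–Schwarz turns the identity into `(s² + s s' + s'²)² ≤ 9 s² s'²`, i.e.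
`(s − s')² ≤ 0` (`not_two_down`); and at most `n + 1` zeros are «upward» (`3 s² q² < ‖w‖²`): `n + 2` of them give a
non-trivial relation `Σ dⱼ wⱼ = 0, Σ dⱼ qⱼ = 0` (dimension count `n + 2 > n + 1`), and expanding `‖Σ dⱼ wⱼ‖² = 0` with the
identity `⟪wⱼ, wₖ⟫ = (sⱼ² + sⱼ sₖ + sₖ²) qⱼ qₖ` (`j ≠ k`) leaves `Σ dⱼ² (‖wⱼ‖² − 3 sⱼ² qⱼ²) + (Σ dⱼ qⱼ sⱼ)² = 0`, impossible
(`up_card_le`).  The Loewner matrix of `s ↦ s³` having one negative square is what makes ratio 3 elementary; the located law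
for a general ratio `b/a > 1` is the same `n + 2` (memo), not typed here.
Nothing in this file is about `WeakLifting` / `TropicalB` in their windows, the doors, `MatrixDescartes` (18050) or VP ≠ VNP.
No `def`; axioms standard.  [folklore linear algebra; the statement itself appears to be new — presearch in the memo]
-/

set_option linter.dupNamespace false
set_option autoImplicit false

namespace Summit.ValiantsHypothesis.ValiantsHypothesis.Theorems.KPlusLogSqLaw

open Matrix Finset
open scoped BigOperators

namespace MixedGauge

variable {n : ℕ}

/-! ## 1. The two-point identity (any parameter values) -/

/-- **Two-point identity.**  For a real symmetric `A`, if `(A + s·1) w + q·v = 0`, `⟪v, w⟫ + (c − t) q = 0` and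
`(A + s'·1) w' + q'·v = 0`, `⟪v, w'⟫ + (c − t') q' = 0`, then `(s' − s)·⟪w, w'⟫ = (t' − t)·q q'`. -/
theorem two_point (A : Matrix (Fin n) (Fin n) ℝ) (hA : A.IsSymm) (v : Fin n → ℝ) (c s t s' t' : ℝ)
    (w w' : Fin n → ℝ) (q q' : ℝ)
    (h1 : (A + s • (1 : Matrix (Fin n) (Fin n) ℝ)) *ᵥ w + q • v = 0) (h2 : v ⬝ᵥ w + (c - t) * q = 0)
    (h1' : (A + s' • (1 : Matrix (Fin n) (Fin n) ℝ)) *ᵥ w' + q' • v = 0) (h2' : v ⬝ᵥ w' + (c - t') * q' = 0) :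
    (s' - s) * (w ⬝ᵥ w') = (t' - t) * (q * q') := by
  -- pair the first block equations with the other kernel vector
  have e1 : w' ⬝ᵥ ((A + s • (1 : Matrix (Fin n) (Fin n) ℝ)) *ᵥ w + q • v) = 0 := by rw [h1, dotProduct_zero]
  have e1' : w ⬝ᵥ ((A + s' • (1 : Matrix (Fin n) (Fin n) ℝ)) *ᵥ w' + q' • v) = 0 := by rw [h1', dotProduct_zero]
  have hsymm : w' ⬝ᵥ (A *ᵥ w) = w ⬝ᵥ (A *ᵥ w') := by
    rw [dotProduct_mulVec, ← Matrix.mulVec_transpose, hA.eq, dotProduct_comm]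
  rw [add_mulVec, dotProduct_add, dotProduct_add, Matrix.smul_mulVec, one_mulVec, dotProduct_smul,
    dotProduct_smul] at e1 e1'
  rw [hsymm, dotProduct_comm w' w, dotProduct_comm w' v] at e1
  rw [dotProduct_comm w v] at e1'
  simp only [smul_eq_mul] at e1 e1'
  -- substitute ⟪v,w⟫ and ⟪v,w'⟫ from the second block equations
  have f2 : v ⬝ᵥ w = -((c - t) * q) := by linarith
  have f2' : v ⬝ᵥ w' = -((c - t') * q') := by linarith
  rw [f2'] at e1
  rw [f2] at e1'
  linear_combination e1' - e1

/-! ## 2. Ratio three: two distinct zeros are never both downward -/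

/-- **No two downward zeros** (fast exponent = 3 × slow exponent, in the variable `s = x^a`).  If `0 < s`, `0 < s'`,
`s ≠ s'`, the two-point identity holds with `t = s³`, `t' = s'³`, both kernel vectors are non-zero and both are
«downward» (`⟪w,w⟫ ≤ 3 s² q²`), contradiction. -/
theorem not_two_down (s s' : ℝ) (hs : 0 < s) (hs' : 0 < s') (hne : s ≠ s') (w w' : Fin n → ℝ) (q q' : ℝ)
    (hid : (s' - s) * (w ⬝ᵥ w') = (s' ^ 3 - s ^ 3) * (q * q'))
    (hnz : w ≠ 0 ∨ q ≠ 0) (hnz' : w' ≠ 0 ∨ q' ≠ 0)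
    (hd : w ⬝ᵥ w ≤ 3 * s ^ 2 * q ^ 2) (hd' : w' ⬝ᵥ w' ≤ 3 * s' ^ 2 * q' ^ 2) : False := by
  -- a downward kernel vector has q ≠ 0
  have hq : q ≠ 0 := by
    rcases hnz with hw | hq
    · intro hq0
      rw [hq0] at hd
      have h0 : w ⬝ᵥ w ≤ 0 := by nlinarith
      have : w ⬝ᵥ w = 0 := le_antisymm h0 (by
        rw [dotProduct]; exact Finset.sum_nonneg fun i _ => mul_self_nonneg _)
      exact hw (dotProduct_self_eq_zero.mp this)
    · exact hq
  have hq' : q' ≠ 0 := by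
    rcases hnz' with hw | hq'
    · intro hq0
      rw [hq0] at hd'
      have h0 : w' ⬝ᵥ w' ≤ 0 := by nlinarith
      have : w' ⬝ᵥ w' = 0 := le_antisymm h0 (by
        rw [dotProduct]; exact Finset.sum_nonneg fun i _ => mul_self_nonneg _)
      exact hw (dotProduct_self_eq_zero.mp this)
    · exact hq'
  -- Cauchy–Schwarz
  have hCS : (w ⬝ᵥ w') ^ 2 ≤ (w ⬝ᵥ w) * (w' ⬝ᵥ w') := by
    have h := Finset.sum_mul_sq_le_sq_mul_sq (Finset.univ : Finset (Fin n)) w w'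
    simpa only [dotProduct, pow_two] using h
  have hww : 0 ≤ w ⬝ᵥ w := by rw [dotProduct]; exact Finset.sum_nonneg fun i _ => mul_self_nonneg _
  have hww' : 0 ≤ w' ⬝ᵥ w' := by rw [dotProduct]; exact Finset.sum_nonneg fun i _ => mul_self_nonneg _
  have hprod : (w ⬝ᵥ w) * (w' ⬝ᵥ w') ≤ (3 * s ^ 2 * q ^ 2) * (3 * s' ^ 2 * q' ^ 2) :=
    mul_le_mul hd hd' hww' (by positivity)
  -- square the identity
  have hsq : (s' - s) ^ 2 * (w ⬝ᵥ w') ^ 2 = (s' ^ 3 - s ^ 3) ^ 2 * (q * q') ^ 2 := by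
    have := congrArg (fun z => z ^ 2) hid
    simpa [mul_pow] using this
  have hD : (s' - s) ^ 2 > 0 := by
    have : s' - s ≠ 0 := sub_ne_zero.mpr (Ne.symm hne)
    positivity
  have hqq : (q * q') ^ 2 > 0 := by
    have : q * q' ≠ 0 := mul_ne_zero hq hq'
    positivity
  -- (s'³ − s³)² (q q')² ≤ (s' − s)² · 9 s² s'² (q q')²
  have h1 : (s' ^ 3 - s ^ 3) ^ 2 * (q * q') ^ 2 ≤ (s' - s) ^ 2 * (9 * (s ^ 2 * s' ^ 2) * (q * q') ^ 2) := by
    rw [← hsq]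
    have : (w ⬝ᵥ w') ^ 2 ≤ 9 * (s ^ 2 * s' ^ 2) * (q * q') ^ 2 := by nlinarith
    exact mul_le_mul_of_nonneg_left this hD.le
  -- factor s'³ − s³ = (s' − s)(s'² + s s' + s²) and cancel the positive factors
  have hE : (s' ^ 2 + s * s' + s ^ 2) ^ 2 ≤ 9 * (s ^ 2 * s' ^ 2) := by
    have h2 : (s' - s) ^ 2 * (q * q') ^ 2 * (s' ^ 2 + s * s' + s ^ 2) ^ 2 ≤
        (s' - s) ^ 2 * (q * q') ^ 2 * (9 * (s ^ 2 * s' ^ 2)) := by nlinarith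
    have hpos : 0 < (s' - s) ^ 2 * (q * q') ^ 2 := mul_pos hD hqq
    exact le_of_mul_le_mul_left h2 hpos
  -- but s'² + s s' + s² − 3 s s' = (s − s')² > 0
  have hgap : 0 < (s - s') ^ 2 := by
    have : s - s' ≠ 0 := sub_ne_zero.mpr hne
    positivity
  nlinarith [mul_pos hs hs']

/-! ## 3. Ratio three: at most `n + 1` upward zeros -/

/-- **Upward zeros are few.**  `n + 2` points `0 < sⱼ`, pairwise distinct, with vectors `wⱼ ∈ ℝⁿ`, scalars `qⱼ`, the
pairwise two-point identities `(sₖ − sⱼ)·⟪wⱼ, wₖ⟫ = (sₖ³ − sⱼ³)·qⱼ qₖ` and all «upward» (`3 sⱼ² qⱼ² < ⟪wⱼ, wⱼ⟫`) cannot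
exist: a relation `Σ dⱼ wⱼ = 0`, `Σ dⱼ qⱼ = 0` (dimension count) would give
`0 = ‖Σ dⱼ wⱼ‖² = Σ dⱼ² (‖wⱼ‖² − 3 sⱼ² qⱼ²) + (Σ dⱼ qⱼ sⱼ)² > 0`. -/
theorem up_card_le (s : Fin (n + 2) → ℝ) (hinj : Function.Injective s)
    (w : Fin (n + 2) → (Fin n → ℝ)) (q : Fin (n + 2) → ℝ)
    (hid : ∀ j k, j ≠ k → (s k - s j) * (w j ⬝ᵥ w k) = (s k ^ 3 - s j ^ 3) * (q j * q k))
    (hup : ∀ j, 3 * s j ^ 2 * q j ^ 2 < w j ⬝ᵥ w j) : False := by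
  classical
  -- the linear map d ↦ (Σ dⱼ wⱼ, Σ dⱼ qⱼ) has a non-trivial kernel
  let f : (Fin (n + 2) → ℝ) →ₗ[ℝ] ((Fin n → ℝ) × ℝ) :=
    { toFun := fun d => (∑ j, d j • w j, ∑ j, d j * q j)
      map_add' := by
        intro d d'
        simp only [Pi.add_apply, add_smul, add_mul, Finset.sum_add_distrib, Prod.mk_add_mk]
      map_smul' := by
        intro r d
        simp only [Pi.smul_apply, smul_eq_mul, mul_smul, ← Finset.smul_sum, RingHom.id_apply, Prod.smul_mk,
          mul_assoc, ← Finset.mul_sum] }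
  have hker : LinearMap.ker f ≠ ⊥ := by
    apply LinearMap.ker_ne_bot_of_finrank_lt
    rw [Module.finrank_prod, Module.finrank_fin_fun, Module.finrank_fin_fun, Module.finrank_self]
    omega
  obtain ⟨d, hdker, hd0⟩ := (Submodule.ne_bot_iff _).mp hker
  have hfd : f d = 0 := LinearMap.mem_ker.mp hdker
  have hsumw : ∑ j, d j • w j = 0 := (Prod.mk_eq_zero.mp hfd).1
  have hsumq : ∑ j, d j * q j = 0 := (Prod.mk_eq_zero.mp hfd).2
  -- Gram entries: ⟪wⱼ, wₖ⟫ = (sⱼ² + sⱼ sₖ + sₖ²) qⱼ qₖ + [j = k] (‖wⱼ‖² − 3 sⱼ² qⱼ²)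
  have hG : ∀ j k, w j ⬝ᵥ w k =
      (s j ^ 2 + s j * s k + s k ^ 2) * (q j * q k) + (if j = k then w j ⬝ᵥ w j - 3 * s j ^ 2 * q j ^ 2 else 0) := by
    intro j k
    by_cases hjk : j = k
    · subst hjk
      rw [if_pos rfl]
      ring
    · rw [if_neg hjk, add_zero]
      have hne : s k - s j ≠ 0 := sub_ne_zero.mpr (fun h => hjk (hinj h).symm)
      have h := hid j k hjk
      have h' : (s k - s j) * (w j ⬝ᵥ w k) = (s k - s j) * ((s j ^ 2 + s j * s k + s k ^ 2) * (q j * q k)) := by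
        rw [h]; ring
      exact mul_left_cancel₀ hne h'
  -- 0 = ‖Σ dⱼ wⱼ‖² expanded
  have hzero : (∑ j, d j • w j) ⬝ᵥ (∑ k, d k • w k) = 0 := by rw [hsumw, dotProduct_zero]
  have hexp : (∑ j, d j • w j) ⬝ᵥ (∑ k, d k • w k) = ∑ j, ∑ k, d j * d k * (w j ⬝ᵥ w k) := by
    rw [sum_dotProduct]
    refine Finset.sum_congr rfl fun j _ => ?_
    rw [dotProduct_sum]
    refine Finset.sum_congr rfl fun k _ => ?_
    rw [smul_dotProduct, dotProduct_smul, smul_eq_mul, smul_eq_mul]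
    ring
  -- evaluate the double sum with the Gram formula
  have hterm : ∀ j k, d j * d k * (w j ⬝ᵥ w k) =
      (d j * q j * s j ^ 2) * (d k * q k) + (d j * q j * s j) * (d k * q k * s k) + (d j * q j) * (d k * q k * s k ^ 2)
        + (if j = k then d j ^ 2 * (w j ⬝ᵥ w j - 3 * s j ^ 2 * q j ^ 2) else 0) := by
    intro j k
    rw [hG j k]
    by_cases hjk : j = k
    · subst hjk; simp only [if_pos]; ring
    · simp only [if_neg hjk]; ring
  have hdouble : ∑ j, ∑ k, d j * d k * (w j ⬝ᵥ w k) =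
      (∑ j, d j * q j * s j ^ 2) * (∑ k, d k * q k) + (∑ j, d j * q j * s j) * (∑ k, d k * q k * s k)
        + (∑ j, d j * q j) * (∑ k, d k * q k * s k ^ 2) + ∑ j, d j ^ 2 * (w j ⬝ᵥ w j - 3 * s j ^ 2 * q j ^ 2) := by
    simp_rw [hterm, Finset.sum_add_distrib, Finset.sum_ite_eq, Finset.mem_univ, if_true, Finset.sum_mul_sum]
  have hq0 : ∑ k, d k * q k = 0 := hsumq
  rw [hexp, hdouble, hq0, mul_zero, zero_mul, zero_add, add_zero] at hzero
  -- both remaining terms are non-negative, and the diagonal one is positive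
  have hsq : 0 ≤ (∑ j, d j * q j * s j) * (∑ k, d k * q k * s k) := mul_self_nonneg _
  have hdiag : 0 < ∑ j, d j ^ 2 * (w j ⬝ᵥ w j - 3 * s j ^ 2 * q j ^ 2) := by
    obtain ⟨j0, hj0⟩ : ∃ j, d j ≠ 0 := by
      by_contra h
      push Not at h
      exact hd0 (funext h)
    apply Finset.sum_pos'
    · intro j _
      exact mul_nonneg (sq_nonneg _) (by linarith [hup j])
    · exact ⟨j0, Finset.mem_univ _, mul_pos (by positivity) (by linarith [hup j0])⟩
  linarith

/-! ## 4. The count: at most `n + 2` distinct positive zeros -/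

/-- **ONE FAST NEGATIVE MODE COSTS AT MOST TWO (ratio three).**  Let `A` be real symmetric `n × n`, `v ∈ ℝⁿ`, `c ∈ ℝ`,
`1 ≤ a`.  If every `x` in a finite set `S` of positive reals admits a non-zero kernel vector `(w, q)` of the bordered matrix
`[[A + x^a·1, v], [vᵀ, c − x^{3a}]]`, i.e. `(A + x^a·1) w + q·v = 0` and `⟪v, w⟫ + (c − x^{3a}) q = 0`, then
`#S ≤ n + 2`. -/
theorem card_posZeros_le (A : Matrix (Fin n) (Fin n) ℝ) (hA : A.IsSymm) (v : Fin n → ℝ) (c : ℝ) (a : ℕ)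
    (ha : 1 ≤ a) (S : Finset ℝ)
    (hS : ∀ x ∈ S, 0 < x ∧ ∃ w : Fin n → ℝ, ∃ q : ℝ, (w ≠ 0 ∨ q ≠ 0) ∧
      (A + (x ^ a) • (1 : Matrix (Fin n) (Fin n) ℝ)) *ᵥ w + q • v = 0 ∧ v ⬝ᵥ w + (c - x ^ (3 * a)) * q = 0) :
    S.card ≤ n + 2 := by
  classical
  -- choose kernel vectors
  have hx : ∀ x : S, 0 < (x : ℝ) := fun x => (hS x x.2).1
  choose W Q hWQ using fun x : S => (hS x x.2).2
  -- in the variable s = x^a: distinct x give distinct s, and x^{3a} = s³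
  have hpow3 : ∀ x : ℝ, x ^ (3 * a) = (x ^ a) ^ 3 := fun x => by rw [mul_comm, pow_mul]
  have hsinj : ∀ x y : S, (x : ℝ) ^ a = (y : ℝ) ^ a → x = y := by
    intro x y h
    have ha0 : a ≠ 0 := by omega
    have := (pow_left_inj₀ (hx x).le (hx y).le ha0).mp h
    exact Subtype.ext this
  -- the two-point identity between any two zeros
  have hid : ∀ x y : S, ((y : ℝ) ^ a - (x : ℝ) ^ a) * (W x ⬝ᵥ W y) =
      (((y : ℝ) ^ a) ^ 3 - ((x : ℝ) ^ a) ^ 3) * (Q x * Q y) := by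
    intro x y
    have h := two_point A hA v c ((x : ℝ) ^ a) ((x : ℝ) ^ (3 * a)) ((y : ℝ) ^ a) ((y : ℝ) ^ (3 * a))
      (W x) (W y) (Q x) (Q y) (hWQ x).2.1 (hWQ x).2.2 (hWQ y).2.1 (hWQ y).2.2
    rw [hpow3, hpow3] at h
    exact h
  -- split S into downward and upward zeros
  let down : ℝ → Prop := fun x => if hxS : x ∈ S then W ⟨x, hxS⟩ ⬝ᵥ W ⟨x, hxS⟩ ≤ 3 * (x ^ a) ^ 2 * Q ⟨x, hxS⟩ ^ 2
    else False
  have hsplit := Finset.card_filter_add_card_filter_not (s := S) down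
  -- at most one downward zero
  have hdown : (S.filter down).card ≤ 1 := by
    refine Finset.card_le_one.mpr ?_
    intro x hxm y hym
    rw [Finset.mem_filter] at hxm hym
    obtain ⟨hxS, hxd⟩ := hxm
    obtain ⟨hyS, hyd⟩ := hym
    simp only [down, dif_pos hxS] at hxd
    simp only [down, dif_pos hyS] at hyd
    by_contra hxy
    have hne : (x : ℝ) ^ a ≠ y ^ a := fun h => hxy (congrArg Subtype.val (hsinj ⟨x, hxS⟩ ⟨y, hyS⟩ h))
    exact not_two_down (x ^ a) (y ^ a) (pow_pos (hx ⟨x, hxS⟩) a) (pow_pos (hx ⟨y, hyS⟩) a) hne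
      (W ⟨x, hxS⟩) (W ⟨y, hyS⟩) (Q ⟨x, hxS⟩) (Q ⟨y, hyS⟩) (hid ⟨x, hxS⟩ ⟨y, hyS⟩)
      (hWQ ⟨x, hxS⟩).1 (hWQ ⟨y, hyS⟩).1 hxd hyd
  -- at most n + 1 upward zeros
  have hupc : (S.filter fun x => ¬ down x).card ≤ n + 1 := by
    by_contra hlt
    push Not at hlt
    obtain ⟨T, hTsub, hTcard⟩ := Finset.exists_subset_card_eq (show n + 2 ≤ (S.filter fun x => ¬ down x).card by omega)
    have hTS : ∀ x ∈ T, x ∈ S := fun x hx => (Finset.mem_filter.mp (hTsub hx)).1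
    have hTup : ∀ x (hx : x ∈ T), 3 * (x ^ a) ^ 2 * Q ⟨x, hTS x hx⟩ ^ 2 < W ⟨x, hTS x hx⟩ ⬝ᵥ W ⟨x, hTS x hx⟩ := by
      intro x hx
      have h := (Finset.mem_filter.mp (hTsub hx)).2
      simp only [down, dif_pos (hTS x hx), not_le] at h
      exact h
    let e : Fin (n + 2) ≃ T := (T.equivFinOfCardEq hTcard).symm
    let emb : Fin (n + 2) → S := fun j => ⟨(e j : ℝ), hTS _ (e j).2⟩
    have hembinj : Function.Injective emb := by
      intro j k h
      have h' : ((emb j : S) : ℝ) = ((emb k : S) : ℝ) := congrArg Subtype.val h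
      exact e.injective (Subtype.ext h')
    refine up_card_le (fun j => ((emb j : S) : ℝ) ^ a) ?_ (fun j => W (emb j)) (fun j => Q (emb j)) ?_ ?_
    · intro j k h
      exact hembinj (hsinj _ _ h)
    · intro j k _
      exact hid (emb j) (emb k)
    · intro j
      exact hTup (e j : ℝ) (e j).2
  omega

/-! ## 5. Determinant currency: the bordered lacunary pencil has at most `n + 2` positive roots -/

/-- the real bordered matrix `[[A + x^a·1, v], [vᵀ, c − x^{3a}]]` at a real point is the evaluation of the polynomial
bordered pencil `[[A + X^a·1, v], [vᵀ, c − X^{3a}]]`. -/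
theorem eval_borderedPencil (A : Matrix (Fin n) (Fin n) ℝ) (v : Fin n → ℝ) (c : ℝ) (a : ℕ) (x : ℝ) :
    (Polynomial.evalRingHom x).mapMatrix
        (Matrix.fromBlocks (A.map Polynomial.C + ((Polynomial.X : Polynomial ℝ) ^ a) • 1)
          (Matrix.of fun i (_ : Unit) => Polynomial.C (v i)) (Matrix.of fun (_ : Unit) j => Polynomial.C (v j))
          ((Polynomial.C c - (Polynomial.X : Polynomial ℝ) ^ (3 * a)) • (1 : Matrix Unit Unit (Polynomial ℝ)))) =
      Matrix.fromBlocks (A + (x ^ a) • (1 : Matrix (Fin n) (Fin n) ℝ)) (Matrix.of fun i (_ : Unit) => v i)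
        (Matrix.of fun (_ : Unit) j => v j) ((c - x ^ (3 * a)) • (1 : Matrix Unit Unit ℝ)) := by
  rw [RingHom.mapMatrix_apply, Matrix.fromBlocks_map]
  congr 1
  · ext i j
    by_cases h : i = j
    · subst h; simp
    · simp [Matrix.one_apply_ne h]
  · ext i j
    simp
  · ext i j
    simp
  · ext i j
    simp

/-- **THE ONE-FAST-MODE LAW, determinant currency (ratio three).**  For `A` real symmetric `n × n`, `v ∈ ℝⁿ`, `c ∈ ℝ` and
`1 ≤ a`, the determinant of the bordered lacunary pencil `[[A + X^a·1, v], [vᵀ, c − X^{3a}]]` — `n` slow positive diagonal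
monomials `X^a` against ONE fast negative diagonal monomial `−X^{3a}`, one constant symmetric letter — has at most `n + 2`
distinct positive real roots (Descartes' rule allows `n + 3` for `n ≥ 2`). -/
theorem card_posRoots_det_borderedPencil_le (A : Matrix (Fin n) (Fin n) ℝ) (hA : A.IsSymm) (v : Fin n → ℝ) (c : ℝ)
    (a : ℕ) (ha : 1 ≤ a) :
    ((Matrix.det (Matrix.fromBlocks (A.map Polynomial.C + ((Polynomial.X : Polynomial ℝ) ^ a) • 1)
          (Matrix.of fun i (_ : Unit) => Polynomial.C (v i)) (Matrix.of fun (_ : Unit) j => Polynomial.C (v j))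
          ((Polynomial.C c - (Polynomial.X : Polynomial ℝ) ^ (3 * a)) • (1 : Matrix Unit Unit (Polynomial ℝ))))).roots.toFinset.filter
        (fun x => 0 < x)).card ≤ n + 2 := by
  classical
  refine card_posZeros_le A hA v c a ha _ ?_
  intro x hx
  rw [Finset.mem_filter, Multiset.mem_toFinset, Polynomial.mem_roots'] at hx
  obtain ⟨⟨_, hroot⟩, hxpos⟩ := hx
  refine ⟨hxpos, ?_⟩
  -- the real bordered matrix at x is singular
  have hdet : (Matrix.fromBlocks (A + (x ^ a) • (1 : Matrix (Fin n) (Fin n) ℝ)) (Matrix.of fun i (_ : Unit) => v i)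
      (Matrix.of fun (_ : Unit) j => v j) ((c - x ^ (3 * a)) • (1 : Matrix Unit Unit ℝ))).det = 0 := by
    rw [← eval_borderedPencil, ← RingHom.map_det]
    exact hroot
  obtain ⟨u, hu0, hu⟩ := Matrix.exists_mulVec_eq_zero_iff.mpr hdet
  -- split the kernel vector into its slow block `u ∘ inl` and fast coordinate `u (inr ())`
  rw [Matrix.fromBlocks_mulVec] at hu
  have h1 := congrFun hu
  have hz : u ∘ Sum.inr = fun _ : Unit => u (Sum.inr ()) := by
    funext i
    rfl
  refine ⟨u ∘ Sum.inl, u (Sum.inr ()), ?_, ?_, ?_⟩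
  · by_contra hboth
    push Not at hboth
    apply hu0
    funext i
    rcases i with i | ⟨⟩
    · exact congrFun hboth.1 i
    · exact hboth.2
  · funext i
    have hi := h1 (Sum.inl i)
    simp only [Sum.elim_inl, Pi.add_apply, Pi.zero_apply] at hi
    have hB : ((Matrix.of fun i (_ : Unit) => v i) *ᵥ (u ∘ Sum.inr)) i = (u (Sum.inr ()) • v) i := by
      simp [Matrix.mulVec, dotProduct, mul_comm]
    rw [hB] at hi
    simpa only [Pi.add_apply, Pi.zero_apply] using hi
  · have hi := h1 (Sum.inr ())
    simp only [Sum.elim_inr, Pi.add_apply, Pi.zero_apply] at hi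
    have hC : ((Matrix.of fun (_ : Unit) j => v j) *ᵥ (u ∘ Sum.inl)) () = v ⬝ᵥ (u ∘ Sum.inl) := by
      simp [Matrix.mulVec]
    have hD : (((c - x ^ (3 * a)) • (1 : Matrix Unit Unit ℝ)) *ᵥ (u ∘ Sum.inr)) () =
        (c - x ^ (3 * a)) * u (Sum.inr ()) := by
      simp [Matrix.mulVec, dotProduct]
    rw [hC, hD] at hi
    exact hi

end MixedGauge

end Summit.ValiantsHypothesis.ValiantsHypothesis.Theorems.KPlusLogSqLaw
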